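import Summits.CriticalPhenomena.PercolationContinuityZ3.Theorems.PercNearOneGluingNoHeavyQuantFarTreeChainStep
import HarnessLib

/-!
# QUANT lane R8 — one step down a relay's chain at an ARBITRARY threshold (the spine identity, generic form)

builds on p205010 (kernel theorem, internal audit signed; external expert review pending)

Support file (`--supports stmt-CriticalPhenomena-4575`), QUANT lane lead (gen 8), rung R8 of
`run/shared/lean/prim/quant/LADDER.md`.  Continues `…QuantFarTreeChainStep.lean` (thresholds `1` and `2`, used for layer one of FAR on
trees) to every threshold `i ≥ 1`, as asked for by the census's SPINE CERTIFICATE programme (prim-quant-census-1/GX-MULTIBLOCK-G8.md §6, README V117: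
`P(N ≥ j+1) = Σ_k P(chain open exactly to level k)·P(S_k ≥ j+1)`, each factor then bounded by union bounds / Harris witnesses / Cantelli).  Generic gate
coordinates (`prodBernoulli q` on `Set ι`, witnesses `y : κ` reached iff `↑(A y) ⊆ ω`); theorems only; no sorries; standard axioms.

Setting of `Quant.count_split`: two disjoint finite families of witnesses, `S₁` (top level: `A b = K ∪ I b`) and `S₂` (the rest: `K ⊆ A y`);
`N = #{y ∈ S₁ ∪ S₂ reached}`, `C = #{b ∈ S₁ : I b open}`, `Y = #{y ∈ S₂ reached}`; pointwise `N = 1[K open]·C + Y` and `Y ≥ 1 ⟹ K open`.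
* `Quant.le_count_eq_union` — for `i ≥ 1`: `{N ≥ i} = {K open, C ≥ i} ∪ ⋃_{c < i} {C = c, Y ≥ i − c}` (pairwise disjoint pieces).
* `Quant.chain_step_real_general` — if `K`, the inner parts and the sets of the rest are supported on pairwise disjoint coordinates:
  `P(N ≥ i) = π(K)·P(C ≥ i) + Σ_{c < i} P(C = c)·P(Y ≥ i − c)` (`i ≥ 1`).  At `i = 1, 2` this is `Quant.chain_step_real`.
Iterating it down the chain of the least likely relay of a tree (template: the induction `hrec` inside `Quant.tree_twoReached_ge`,
`…QuantFarTreeMultiCompanion.lean`, with the level bookkeeping of `…QuantFarTreeChainLevels.lean`) gives the spine identity at every layer.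
[this work]; independence of disjointly supported events [cite: Grimmett1999, §2.2].
-/

noncomputable section

namespace Summit.CriticalPhenomena.PercolationContinuityZ3.Theorems

namespace Quant

open Finset MeasureTheory
open Literature.Probability.LatticeModels
open Literature.Probability.Percolation
open scoped Classical

variable {ι κ : Type*}

/-- **`{N ≥ i}` split at the top level, any threshold `i ≥ 1`**:
`{N ≥ i} = {K open, C ≥ i} ∪ ⋃_{c < i} {C = c, Y ≥ i − c}`. [this work] -/
theorem le_count_eq_union (A I : κ → Finset ι) (K : Finset ι) (S₁ S₂ : Finset κ) (hdisj : Disjoint S₁ S₂)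
    (hA₁ : ∀ b ∈ S₁, A b = K ∪ I b) (hA₂ : ∀ y ∈ S₂, K ⊆ A y) (i : ℕ) (hi : 1 ≤ i) :
    {ω : Set ι | i ≤ ((S₁ ∪ S₂).filter fun y => ((A y : Finset ι) : Set ι) ⊆ ω).card} =
      ({ω : Set ι | ((K : Finset ι) : Set ι) ⊆ ω} ∩ {ω | i ≤ (S₁.filter fun b => ((I b : Finset ι) : Set ι) ⊆ ω).card}) ∪
        ⋃ c ∈ Finset.range i, ({ω : Set ι | (S₁.filter fun b => ((I b : Finset ι) : Set ι) ⊆ ω).card = c} ∩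
          {ω | i - c ≤ (S₂.filter fun y => ((A y : Finset ι) : Set ι) ⊆ ω).card}) := by
  ext ω
  obtain ⟨hN, hY⟩ := count_split A I K S₁ S₂ hdisj hA₁ hA₂ ω
  simp only [Set.mem_setOf_eq, Set.mem_union, Set.mem_inter_iff, Set.mem_iUnion, Finset.mem_range, exists_prop]
  rw [hN]
  by_cases hK : ((K : Finset ι) : Set ι) ⊆ ω
  · simp only [hK, ↓reduceIte, true_and]
    constructor
    · intro h
      by_cases hC : i ≤ (S₁.filter fun b => ((I b : Finset ι) : Set ι) ⊆ ω).card
      · exact Or.inl hC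
      · right
        exact ⟨(S₁.filter fun b => ((I b : Finset ι) : Set ι) ⊆ ω).card, by omega, rfl, by omega⟩
    · rintro (h | ⟨c, hc, hCc, hYc⟩)
      · omega
      · omega
  · simp only [hK, ↓reduceIte, false_and, false_or, zero_add]
    have hY0 : (S₂.filter fun y => ((A y : Finset ι) : Set ι) ⊆ ω).card < 1 := by
      by_contra h
      exact hK (hY (not_lt.1 h))
    constructor
    · intro h; omega
    · rintro ⟨c, hc, -, hYc⟩; omega

variable [Finite ι]

/-- **One step down the chain at threshold `i ≥ 1` (probabilities).**  In the situation of `le_count_eq_union`, if `K` is disjoint from the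
inner parts `I b` (`b ∈ S₁`) and these are disjoint from the sets `A y` (`y ∈ S₂`):
`P(N ≥ i) = π(K)·P(C ≥ i) + Σ_{c < i} P(C = c)·P(Y ≥ i − c)`. [this work] -/
theorem chain_step_real_general (q : ι → unitInterval) (A I : κ → Finset ι) (K : Finset ι) (S₁ S₂ : Finset κ)
    (hdisj : Disjoint S₁ S₂) (hA₁ : ∀ b ∈ S₁, A b = K ∪ I b) (hA₂ : ∀ y ∈ S₂, K ⊆ A y) (hKI : ∀ b ∈ S₁, Disjoint K (I b))
    (hIA : ∀ b ∈ S₁, ∀ y ∈ S₂, Disjoint (I b) (A y)) (i : ℕ) (hi : 1 ≤ i) :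
    (prodBernoulli q).real {ω : Set ι | i ≤ ((S₁ ∪ S₂).filter fun y => ((A y : Finset ι) : Set ι) ⊆ ω).card} =
      (∏ x ∈ K, (q x : ℝ)) * (prodBernoulli q).real {ω : Set ι | i ≤ (S₁.filter fun b => ((I b : Finset ι) : Set ι) ⊆ ω).card} +
        ∑ c ∈ Finset.range i,
          (prodBernoulli q).real {ω : Set ι | (S₁.filter fun b => ((I b : Finset ι) : Set ι) ⊆ ω).card = c} *
            (prodBernoulli q).real {ω : Set ι | i - c ≤ (S₂.filter fun y => ((A y : Finset ι) : Set ι) ⊆ ω).card} := by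
  set μ := prodBernoulli q with hμ
  have hmeas : ∀ T : Set (Set ι), MeasurableSet T := fun T => (Set.toFinite T).measurableSet
  -- supports
  set F : Finset ι := S₁.biUnion I with hF
  set R : Finset ι := S₂.biUnion A with hR
  have hKF : Disjoint K F := by
    rw [hF, Finset.disjoint_biUnion_right]; exact hKI
  have hFR : Disjoint F R := by
    rw [hF, Finset.disjoint_biUnion_left]
    intro b hb
    rw [hR, Finset.disjoint_biUnion_right]
    exact hIA b hb
  have hIF : ∀ b ∈ S₁, I b ⊆ F := fun b hb => Finset.subset_biUnion_of_mem I hb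
  have hAR : ∀ y ∈ S₂, A y ⊆ R := fun y hy => Finset.subset_biUnion_of_mem A hy
  set EK := {ω : Set ι | ((K : Finset ι) : Set ι) ⊆ ω} with hEK
  set Cge := {ω : Set ι | i ≤ (S₁.filter fun b => ((I b : Finset ι) : Set ι) ⊆ ω).card} with hCge
  set Ceq : ℕ → Set (Set ι) := fun c => {ω : Set ι | (S₁.filter fun b => ((I b : Finset ι) : Set ι) ⊆ ω).card = c} with hCeq
  set Yge : ℕ → Set (Set ι) := fun c => {ω : Set ι | i - c ≤ (S₂.filter fun y => ((A y : Finset ι) : Set ι) ⊆ ω).card} with hYge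
  have hPK : μ.real EK = ∏ x ∈ K, (q x : ℝ) := prodBernoulli_real_subset q K
  have dK : DeterminedBy EK (↑K : Set ι) := determinedBy_subset_open K
  have dC : ∀ Φ : ℕ → Prop, DeterminedBy {ω : Set ι | Φ ((S₁.filter fun b => ((I b : Finset ι) : Set ι) ⊆ ω).card)} (↑F : Set ι) :=
    fun Φ => determinedBy_card_filter_open S₁ I F hIF Φ
  have dY : ∀ Φ : ℕ → Prop, DeterminedBy {ω : Set ι | Φ ((S₂.filter fun y => ((A y : Finset ι) : Set ι) ⊆ ω).card)} (↑R : Set ι) :=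
    fun Φ => determinedBy_card_filter_open S₂ A R hAR Φ
  have p1 : μ.real (EK ∩ Cge) = μ.real EK * μ.real Cge :=
    prodBernoulli_real_inter_of_determinedBy_disjoint q hKF dK (dC fun n => i ≤ n) (hmeas _) (hmeas _)
  have pc : ∀ c, μ.real (Ceq c ∩ Yge c) = μ.real (Ceq c) * μ.real (Yge c) := fun c =>
    prodBernoulli_real_inter_of_determinedBy_disjoint q hFR (dC fun n => n = c) (dY fun n => i - c ≤ n) (hmeas _) (hmeas _)
  rw [le_count_eq_union A I K S₁ S₂ hdisj hA₁ hA₂ i hi]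
  -- the pieces are pairwise disjoint
  have hdj_fam : (↑(Finset.range i) : Set ℕ).PairwiseDisjoint fun c => Ceq c ∩ Yge c := by
    intro c _ c' _ hcc'
    rw [Function.onFun, Set.disjoint_left]
    intro ω h h'
    have a := h.1; have b := h'.1
    simp only [hCeq, Set.mem_setOf_eq] at a b
    exact hcc' (a.symm.trans b)
  have hdj1 : Disjoint (EK ∩ Cge) (⋃ c ∈ Finset.range i, (Ceq c ∩ Yge c)) := by
    rw [Set.disjoint_left]
    intro ω h h'
    obtain ⟨c, hc, hc'⟩ := Set.mem_iUnion₂.1 h'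
    have a := h.2; have b := hc'.1
    simp only [hCge, hCeq, Set.mem_setOf_eq] at a b
    have := Finset.mem_range.1 hc
    omega
  rw [measureReal_union hdj1 (hmeas _) (measure_ne_top _ _) (measure_ne_top _ _),
    measureReal_biUnion_finset hdj_fam (fun c _ => hmeas _) (fun c _ => measure_ne_top _ _), p1, hPK]
  congr 1
  exact Finset.sum_congr rfl fun c _ => pc c

end Quant

end Summit.CriticalPhenomena.PercolationContinuityZ3.Theorems

end
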